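import Mathlib.Algebra.BigOperators.Pi
import Mathlib.GroupTheory.Index
import Literature.IUT.HodgeTheaters.PuncturedEllipticArrowModelCoords
import HarnessLib

/-!
# The finite model of [IUTchI] §1, part 3: `jKer = K` — the kernel of `Δ_X̲ ↠ Δ_ε⁺` is generated as printed (proof-only)

Mochizuki, *Inter-universal Teichmüller theory I*, kurims manuscript (May 2020), §1 pp. 37–38
([IUTchI] §1 p.38) [claim: Mochizuki2012, status: disputed] (D-0012 claim key; series status DISPUTED —
WITNESS-class, pure finite group theory over `PuncturedEllipticArrowModel(Coords).lean`; nothing of the series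
is asserted, no side is taken on [IUTchIII] Cor. 3.12).

In the model `Π_C = N ⋊ D_l` of abc-iut-L5-t1 (parts 1–2) this file computes the two subgroups that the §1
CONSTRUCTION (`PuncturedEllipticData.jKer`, `galKer`) will produce, and the printed indices:
* `sup_closure_commSet_eq_Khat` — `(⨆_{x ∉ {0,±1}} D_x) ⊔ ⟨x c x⁻¹ c⁻¹⟩ = K := {(A,f,1) : f(0) = f(1)}`: the
  inertia of the other nonzero cusps together with the `(−1)`-eigenspace `(1 − ι̲)N` span exactly the kernel
  of the `Δ_ε⁺`-coordinate `ℓ` (p. 38 "`Δ_ε ⥲ Δ_ε⁺ × Δ_ε⁻`", "`J_X = Π_X̲/…`"); the proof decomposes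
  `f = f(0)(B_0 + B_1) + Σ_{j ∉ {0,1}} f(j) B_j` with `B_0 + B_1`, `A` commutators and
  `2 B_j = (B_j + B_{1−j}) + (B_j − B_{1−j})`, the last a telescoping sum of allowed inertia `c_2, …, c_{l−2}`;
* (part 3b, `PuncturedEllipticArrowModelIndices.lean`: `galKer = K′`, the indices `l, 2, 2l, l, 2, l`, and
  `D_{±1} ⊔ K = N`).
PROOF-ONLY (no definition, no instance); symbolic `l` (hypotheses `5 ≤ l`, `Odd l` where used); axioms standard.
-/

namespace Literature.IUT.HodgeTheaters

namespace PuncturedEllipticData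

namespace ArrowModel

open DihedralGroup
open scoped Pointwise

variable (l : ℕ)

/-! ### Small facts in `ℤ/l` -/

/-- For `5 ≤ l`: `ℤ/l` is nontrivial and `l ≠ 0`. [claim: Mochizuki2012, status: disputed] -/
theorem neZero_of_five_le (h5 : 5 ≤ l) : NeZero l := ⟨by omega⟩

/-- A natural number `0 < a < l` is nonzero in `ℤ/l`. [claim: Mochizuki2012, status: disputed] -/
theorem natCast_ne_zero_of_lt {a : ℕ} (ha : 0 < a) (hal : a < l) : (a : ZMod l) ≠ 0 := by
  intro h
  rw [ZMod.natCast_eq_zero_iff] at h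
  exact absurd (Nat.le_of_dvd ha h) (by omega)

/-- Two naturals `< l` with equal images in `ℤ/l` are equal. [claim: Mochizuki2012, status: disputed] -/
theorem natCast_injOn {a b : ℕ} (hal : a < l) (hbl : b < l) (h : (a : ZMod l) = (b : ZMod l)) : a = b := by
  rw [ZMod.natCast_eq_natCast_iff'] at h
  rwa [Nat.mod_eq_of_lt hal, Nat.mod_eq_of_lt hbl] at h

/-- `l • v = 0` in `N` (`N` has exponent `l`). [claim: Mochizuki2012, status: disputed] -/
theorem l_nsmul_eq_zero (v : V l) : l • v = 0 := by
  ext m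
  · rw [Prod.smul_fst, nsmul_eq_mul, ZMod.natCast_self, zero_mul, Prod.fst_zero]
  · rw [Prod.smul_snd, Pi.smul_apply, nsmul_eq_mul, ZMod.natCast_self, zero_mul, Prod.snd_zero,
      Pi.zero_apply]

/-- `(l + 1) • v = v` in `N`. [claim: Mochizuki2012, status: disputed] -/
theorem succ_l_nsmul (v : V l) : (l + 1) • v = v := by
  rw [succ_nsmul, l_nsmul_eq_zero, zero_add]

/-! ### The generators lie in `K` -/

/-- `⨆_{x ∉ {0, ±1}} D_x ≤ K`. ([IUTchI] §1 p.37) [claim: Mochizuki2012, status: disputed] -/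
theorem EpsSup_le_Khat : EpsSup l ≤ Khat l :=
  iSup_le fun x => Dm_le_Khat l x.2.1 x.2.2.1 x.2.2.2

/-- The commutators `x c x⁻¹ c⁻¹` (`x ∈ N`, `c ∈ Π_C̲ ∖ N`) are exactly the elements `(v − σ_0 v, 1)`.
([IUTchI] §1 p.38) [claim: Mochizuki2012, status: disputed] -/
theorem exists_eq_inN_sub_refl_of_mem_commSet {z : G l} (hz : z ∈ commSet l) :
    ∃ v : V l, z = inN l (v - refl l 0 v) := by
  obtain ⟨x, hx, c, hc, hcN, rfl⟩ := hz
  have hcs : c.right = sr 0 := by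
    rcases hc with h | h
    · exact absurd ((mem_Nhat_iff l c).mpr h) hcN
    · exact h
  refine ⟨Multiplicative.toAdd x.left, ?_⟩
  set v := Multiplicative.toAdd x.left with hv
  have hx' : x = inN l v := eq_inN_of_right_eq_one l ((mem_Nhat_iff l x).mp hx)
  rw [hx', mul_assoc, mul_assoc, ← mul_assoc c, ← inN_neg, conj_inN, hcs, dact_sr, ← inN_add, map_neg,
    sub_eq_add_neg]

/-- `(v − σ_0 v, 1)` is such a commutator (with `x = (v, 1)`, `c = ŝ`). ([IUTchI] §1 p.38)
[claim: Mochizuki2012, status: disputed] -/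
theorem inN_sub_refl_mem_commSet (v : V l) : inN l (v - refl l 0 v) ∈ commSet l := by
  refine ⟨inN l v, inN_mem_Nhat l v, sigmaHat l, sigmaHat_mem_PiCbarm l, sigmaHat_not_mem_Nhat l, ?_⟩
  rw [mul_assoc, mul_assoc, ← mul_assoc (sigmaHat l), ← inN_neg, conj_inN, sigmaHat_right, dact_sr,
    ← inN_add, map_neg, sub_eq_add_neg]

/-- `ℓ(v − σ_0 v) = 0`. [claim: Mochizuki2012, status: disputed] -/
theorem ell_sub_refl (v : V l) : ell l (v - refl l 0 v) = 0 := by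
  rw [map_sub, ell_refl_zero, sub_self]

/-- `⟨commutators⟩ ≤ K`. ([IUTchI] §1 p.38) [claim: Mochizuki2012, status: disputed] -/
theorem closure_commSet_le_Khat : Subgroup.closure (commSet l) ≤ Khat l := by
  rw [Subgroup.closure_le]
  intro z hz
  obtain ⟨v, rfl⟩ := exists_eq_inN_sub_refl_of_mem_commSet l hz
  exact (inN_mem_Khat_iff l _).mpr (ell_sub_refl l v)

/-! ### `K` is generated: every element of `K` is a product of the generators -/

/-- `(v − σ_0 v, 1) ∈ ⨆ D_x ⊔ ⟨commutators⟩`. [claim: Mochizuki2012, status: disputed] -/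
theorem inN_sub_refl_mem_sup (v : V l) :
    inN l (v - refl l 0 v) ∈ EpsSup l ⊔ Subgroup.closure (commSet l) :=
  Subgroup.mem_sup_right (Subgroup.subset_closure (inN_sub_refl_mem_commSet l v))

/-- The `A`-direction is a commutator: `(A, 0) = u − σ_0 u` with `u = ((q+1)A, 0)`, `l = 2q + 1`.
([IUTchI] §1 p.38) [claim: Mochizuki2012, status: disputed] -/
theorem inN_fst_mem_sup {q : ℕ} (hq : l = 2 * q + 1) (A : ZMod l) :
    inN l (A, 0) ∈ EpsSup l ⊔ Subgroup.closure (commSet l) := by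
  have h2 : (2 * (q + 1 : ℕ) : ZMod l) = 1 := by
    have : ((2 * (q + 1) : ℕ) : ZMod l) = ((l + 1 : ℕ) : ZMod l) := by rw [hq]; ring_nf
    rw [← Nat.cast_ofNat, ← Nat.cast_mul, this, Nat.cast_succ, ZMod.natCast_self, zero_add]
  have key : ((A, 0) : V l) = ((q + 1 : ℕ) * A, 0) - refl l 0 ((q + 1 : ℕ) * A, 0) := by
    ext m
    · simp only [refl_apply, Prod.fst_sub, sub_neg_eq_add]
      linear_combination -A * h2
    · simp only [refl_apply, Prod.snd_sub, Pi.sub_apply, Pi.zero_apply, neg_zero, sub_zero]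
  rw [key]
  exact inN_sub_refl_mem_sup l _

/-- `B_j + B_{1−j}` is a commutator: `(0, δ_j + δ_{1−j}) = u − σ_0 u`, `u = (0, δ_j)`.
([IUTchI] §1 p.38) [claim: Mochizuki2012, status: disputed] -/
theorem inN_δ_add_δ_mem_sup (j : ZMod l) :
    inN l (0, δ l j + δ l (1 - j)) ∈ EpsSup l ⊔ Subgroup.closure (commSet l) := by
  have key : ((0, δ l j + δ l (1 - j)) : V l) = (0, δ l j) - refl l 0 (0, δ l j) := by
    ext m
    · simp
    · simp only [refl_apply, Prod.snd_sub, Pi.add_apply, Pi.sub_apply, sub_neg_eq_add, δ_apply, sub_zero]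
      have h : (1 - m = j) ↔ (m = 1 - j) :=
        ⟨fun h => by linear_combination -h, fun h => by linear_combination -h⟩
      simp only [h]
  rw [key]
  exact inN_sub_refl_mem_sup l _

/-- The telescoping sum `δ_{n+2} − δ_2 = c_2 + ⋯ + c_{n+1}` lies in `⨆_{x ∉ {0,±1}} D_x` (`n + 2 < l`).
([IUTchI] §1 p.37) [claim: Mochizuki2012, status: disputed] -/
theorem inN_δ_sub_δ_two_mem_EpsSup (h3 : 3 ≤ l) :
    ∀ n : ℕ, n + 2 < l → inN l (0, δ l ((n + 2 : ℕ) : ZMod l) - δ l 2) ∈ EpsSup l := by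
  intro n
  induction n with
  | zero =>
    intro _
    rw [Nat.zero_add, Nat.cast_ofNat, sub_self, ← Prod.zero_eq_mk, inN_zero]
    exact (EpsSup l).one_mem
  | succ n ih =>
    intro hn
    have hmem := ih (by omega)
    -- `δ_{n+3} − δ_2 = c_{n+2} + (δ_{n+2} − δ_2)`
    have key : ((0, δ l ((n + 1 + 2 : ℕ) : ZMod l) - δ l 2) : V l) =
        cvec l ((n + 2 : ℕ) : ZMod l) + (0, δ l ((n + 2 : ℕ) : ZMod l) - δ l 2) := by
      ext m
      · simp [cvec]
      · simp only [cvec, Prod.snd_add, Pi.add_apply, Pi.sub_apply]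
        rw [show ((n + 1 + 2 : ℕ) : ZMod l) = ((n + 2 : ℕ) : ZMod l) + 1 by push_cast; ring]
        ring
    rw [key, inN_add]
    refine (EpsSup l).mul_mem ?_ hmem
    -- `ĉ_{n+2} ∈ D_{n+2} ≤ EpsSup` since `n + 2 ∉ {0, 1, −1}`
    have h0 : ((n + 2 : ℕ) : ZMod l) ≠ 0 := natCast_ne_zero_of_lt l (by omega) (by omega)
    have h1 : ((n + 2 : ℕ) : ZMod l) ≠ 1 := by
      intro h
      rw [← Nat.cast_one] at h
      exact absurd (natCast_injOn l (by omega) (by omega) h) (by omega)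
    have h2 : ((n + 2 : ℕ) : ZMod l) ≠ -1 := by
      intro h
      have h' : ((n + 3 : ℕ) : ZMod l) = 0 := by push_cast at h ⊢; linear_combination h
      exact natCast_ne_zero_of_lt l (by omega) hn h'
    have hle : Dm l ((n + 2 : ℕ) : ZMod l) ≤ EpsSup l :=
      le_iSup (fun x : {x : ZMod l // x ≠ 0 ∧ x ≠ 1 ∧ x ≠ -1} => Dm l x.1) ⟨_, h0, h1, h2⟩
    exact hle (Subgroup.mem_zpowers _)

/-- For `j ∉ {0, 1}`: `(0, δ_j − δ_2) ∈ ⨆_{x ∉ {0,±1}} D_x`. [claim: Mochizuki2012, status: disputed] -/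
theorem inN_δ_sub_δ_two_mem_EpsSup' [NeZero l] (h3 : 3 ≤ l) {j : ZMod l} (hj0 : j ≠ 0) (hj1 : j ≠ 1) :
    inN l (0, δ l j - δ l 2) ∈ EpsSup l := by
  have hv0 : j.val ≠ 0 := fun h => hj0 ((ZMod.val_eq_zero j).mp h)
  have hv1 : j.val ≠ 1 := by
    intro h
    apply hj1
    have := ZMod.natCast_zmod_val j
    rw [h, Nat.cast_one] at this
    exact this.symm
  have hlt := ZMod.val_lt j
  obtain ⟨n, hn⟩ : ∃ n : ℕ, j.val = n + 2 := ⟨j.val - 2, by omega⟩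
  have h := inN_δ_sub_δ_two_mem_EpsSup l h3 n (by omega)
  rwa [← hn, ZMod.natCast_zmod_val] at h

/-- For `j ∉ {0, 1}`: `(0, δ_j) ∈ ⨆ D_x ⊔ ⟨commutators⟩` (`2δ_j = (δ_j + δ_{1−j}) + (δ_j − δ_{1−j})`, and `2`
is invertible). ([IUTchI] §1 p.38) [claim: Mochizuki2012, status: disputed] -/
theorem inN_δ_mem_sup [NeZero l] {q : ℕ} (hq : l = 2 * q + 1) (h3 : 3 ≤ l) {j : ZMod l}
    (hj0 : j ≠ 0) (hj1 : j ≠ 1) : inN l (0, δ l j) ∈ EpsSup l ⊔ Subgroup.closure (commSet l) := by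
  have hj0' : (1 - j) ≠ 0 := fun h => hj1 (by linear_combination -h)
  have hj1' : (1 - j) ≠ 1 := fun h => hj0 (by linear_combination -h)
  -- `(0, δ_j − δ_{1−j}) ∈ EpsSup`
  have hdiff : inN l (0, δ l j - δ l (1 - j)) ∈ EpsSup l := by
    have e : ((0, δ l j - δ l (1 - j)) : V l) = (0, δ l j - δ l 2) - (0, δ l (1 - j) - δ l 2) := by
      ext m <;> simp
    rw [e, sub_eq_add_neg, inN_add, inN_neg]
    exact (EpsSup l).mul_mem (inN_δ_sub_δ_two_mem_EpsSup' l h3 hj0 hj1)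
      ((EpsSup l).inv_mem (inN_δ_sub_δ_two_mem_EpsSup' l h3 hj0' hj1'))
  -- `(0, 2 δ_j) ∈ S`
  have htwo : inN l ((2 : ℕ) • (0, δ l j)) ∈ EpsSup l ⊔ Subgroup.closure (commSet l) := by
    have e : ((2 : ℕ) • (0, δ l j) : V l) = (0, δ l j + δ l (1 - j)) + (0, δ l j - δ l (1 - j)) := by
      ext m
      · simp
      · simp only [Prod.snd_add, Pi.add_apply, Pi.sub_apply, two_nsmul]
        ring
    rw [e, inN_add]
    exact Subgroup.mul_mem _ (inN_δ_add_δ_mem_sup l j) (Subgroup.mem_sup_left hdiff)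
  -- `δ_j = (q+1) • (2 δ_j)`
  have e : ((0, δ l j) : V l) = (q + 1) • ((2 : ℕ) • ((0, δ l j) : V l)) := by
    rw [← mul_nsmul', show (q + 1) * 2 = l + 1 by omega, succ_l_nsmul]
  rw [e, inN_nsmul]
  exact Subgroup.pow_mem _ htwo _

/-- **`K ≤ ⨆_{x ∉ {0,±1}} D_x ⊔ ⟨commutators⟩`**: every `(A, f, 1)` with `f(0) = f(1)` is a product of the
generators. ([IUTchI] §1 p.38) [claim: Mochizuki2012, status: disputed] -/
theorem Khat_le_sup [NeZero l] {q : ℕ} (hq : l = 2 * q + 1) (h3 : 3 ≤ l) :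
    Khat l ≤ EpsSup l ⊔ Subgroup.closure (commSet l) := by
  intro g hg
  obtain ⟨hg1, hg2⟩ := hg
  set S := EpsSup l ⊔ Subgroup.closure (commSet l) with hS
  rw [eq_inN_of_right_eq_one l hg1]
  set v := Multiplicative.toAdd g.left with hv
  have hℓ : v.2 0 = v.2 1 := sub_eq_zero.mp hg2
  -- split `v = (A, 0) + (0, f)`
  have e1 : v = (v.1, 0) + (0, v.2) := by ext <;> simp
  rw [e1, inN_add]
  refine S.mul_mem (inN_fst_mem_sup l hq v.1) ?_
  -- `f = Σ_j single j (f j)`, split off `j = 0, 1`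
  have hne : (1 : ZMod l) ≠ 0 := by
    haveI : Fact (1 < l) := ⟨by omega⟩
    exact one_ne_zero
  have e2 : ((0, v.2) : V l) = ∑ j, ((0, Pi.single j (v.2 j)) : V l) := by
    ext m
    · rw [Prod.fst_sum]; simp
    · rw [Prod.snd_sum]
      simp only
      rw [Finset.sum_apply, ← congrFun (Finset.univ_sum_single v.2) m, Finset.sum_apply]
  have h1mem : (1 : ZMod l) ∈ Finset.univ.erase (0 : ZMod l) := Finset.mem_erase.mpr ⟨hne, Finset.mem_univ _⟩
  rw [e2, ← Finset.add_sum_erase _ _ (Finset.mem_univ (0 : ZMod l)), ← Finset.add_sum_erase _ _ h1mem,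
    ← add_assoc, inN_add]
  refine S.mul_mem ?_ ?_
  · -- `single 0 (f 0) + single 1 (f 1) = (f 0).val • (δ_0 + δ_1)`
    have e3 : ((0, Pi.single (0 : ZMod l) (v.2 0)) : V l) + (0, Pi.single (1 : ZMod l) (v.2 1)) =
        (v.2 0).val • ((0, δ l 0 + δ l (1 - 0)) : V l) := by
      rw [← hℓ, sub_zero]
      ext m
      · simp
      · simp only [Prod.snd_add, Pi.add_apply, Prod.smul_snd, Pi.smul_apply, single_eq_nsmul_δ, smul_add]
    rw [e3, inN_nsmul]
    exact S.pow_mem (inN_δ_add_δ_mem_sup l 0) _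
  · refine inN_sum_mem l S _ _ fun j hj => ?_
    rw [Finset.mem_erase, Finset.mem_erase] at hj
    obtain ⟨hj1, hj0, -⟩ := hj
    have e4 : ((0, Pi.single j (v.2 j)) : V l) = (v.2 j).val • ((0, δ l j) : V l) := by
      ext m
      · simp
      · simp only [Prod.smul_snd, single_eq_nsmul_δ]
    rw [e4, inN_nsmul]
    exact S.pow_mem (inN_δ_mem_sup l hq h3 hj0 hj1) _

/-- **`jKer` of the model**: `(⨆_{x ∉ {0,±1}} D_x) ⊔ ⟨x c x⁻¹ c⁻¹⟩ = K`. ([IUTchI] §1 p.38)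
[claim: Mochizuki2012, status: disputed] -/
theorem sup_closure_commSet_eq_Khat [NeZero l] {q : ℕ} (hq : l = 2 * q + 1) (h3 : 3 ≤ l) :
    EpsSup l ⊔ Subgroup.closure (commSet l) = Khat l :=
  le_antisymm (sup_le (EpsSup_le_Khat l) (closure_commSet_le_Khat l)) (Khat_le_sup l hq h3)

end ArrowModel

end PuncturedEllipticData

end Literature.IUT.HodgeTheaters
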